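import Literature.AlgebraicGeometry.Motives.HodgeStructureExtendedLefschetzGroupPoints
import Literature.AlgebraicGeometry.Motives.HodgeStructureCentralizerEquivariantForms
import HarnessLib

/-!
# Milne 1999 Definition 4.3 read through Hodge classes: `L(H)(K)` is the group of pairs `(γ, c)` fixing every class of
# `H ⊗ H → ℚ(-n)` — every divisor-type `2`-form — and `S(H)(K)` the automorphisms fixing them exactly

[topic AlgebraicGeometry/Motives]

Layer `Literature/AlgebraicGeometry/Motives`, lane `lit-hodgefound` (Track 2 foundations library; seat `lit-hodgefound-p34`,
generation 19, FILE 2 of the self-proposed row g19-#1 of `run/shared/lean/pub/lit-hodgefound/SKELETON.md`). THEOREMS ONLY (no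
definition, no named fact; net debt `0`). FILE 1 `Motives/HodgeStructureExtendedLefschetzGroupPoints` defines Milne's
`L(A) ⊂ GL(V(A)) × 𝔾_m` on `K`-points, `L(H)(K) = Polarization.extendedLefschetzGroupBaseChange K Q`, as the pairs `(γ, c)` with
`Q_K(a_K γ x, γ y) = c · Q_K(a_K x, y)` for every Hodge endomorphism `a ∈ E_φ` — the divisor classes `e_D = e_{D₀} ∘ (β × 1)` being
read as the twists `Q(a ·, ·)`. This file proves that reading EQUIVALENT to the one by Hodge classes: by the seat's g18-#2
`Motives/HodgeStructureCentralizerEquivariantForms` (Milne Prop. 1.3 on this carrier) a bilinear form `B` on `V` is such a twist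
iff `v ⊗ w ↦ B(v, w)` underlies a morphism of Hodge structures `H ⊗ H → ℚ(-n)` iff `B` is `†`-equivariant under Milne's
centraliser `C(H)` — so `L(H)(K)` IS the group of pairs fixing every Hodge class among the `2`-forms (for `H¹` of an abelian
variety: the classes in `H¹ ⊗ H¹ ⊂ H²(A × A)` of the divisors of `A × A`, Lefschetz (1,1)), in the normalisation
`B_K(γ x, γ y) = c · B_K(x, y)`, and `S(H)(K)` the automorphisms fixing them on the nose.

## The source, verbatim

J. S. Milne, *Lefschetz classes on abelian varieties*, Duke Math. J. **96** (1999) 639–675 [Milne1999LefschetzClasses] (held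
`paper:doi-10-1215-s0012-7094-99-09620-5`): §4 p0021 L1–L4 (p. 659) "**Definition 4.3.** The Lefschetz group `L(A)` of an
abelian variety `A` over `Ω` is the largest algebraic subgroup of `GL(V(A)) × 𝔾_m/k` fixing the elements of
`D^s_hom(A^r)_k ⊂ H^{2s}(A^r)(s)` for all `r, s`."; p. 659 L28–L31 "the kernel of `l(A)`, regarded as a subgroup of `GL(V(A))`,
equals `S(A)`"; §1 Prop. 1.3 (p. 643) "The skew-symmetric `k`-bilinear forms `ψ` such that `ψ ∘ (γ × 1) = ψ ∘ (1 × γ†)`, all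
`γ ∈ C(A)`, are exactly the `k`-linear combinations of forms `e_D` with `D` a divisor on `A`."; B. Moonen, *Families of Motives
and the Mumford–Tate Conjecture* (2017) §2.1 / P. Deligne, *Théorie de Hodge II* 2.1.15: a polarization — a divisor-type class —
is a morphism of Hodge structures `H ⊗ H → ℚ(-n)` [Moonen2017FamiliesMotives] [DeligneHodgeII1971].

## What is PROVED (field `K ⊇ ℚ`, polarized `(H, Q)`, `V` finite-dimensional)

* `Polarization.mem_extendedLefschetzGroupBaseChange_iff_forall_hom`: **`(γ, c) ∈ L(H)(K)` iff for EVERY bilinear form `B` on `V`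
  underlying a morphism `H ⊗ H → ℚ(-n)`, `B_K(γ x, γ y) = c · B_K(x, y)`**.
* `Polarization.mem_extendedLefschetzGroupBaseChange_iff_forall_adjoint` — the same with Milne's Prop. 1.3 description of the
  divisor-type forms ("`ψ ∘ (γ × 1) = ψ ∘ (1 × γ†)` for all `γ ∈ C(A)`").
* `Polarization.mem_lefschetzGroupBaseChange_iff_forall_hom` / `…_iff_forall_adjoint`: **`γ ∈ S(H)(K)` iff `γ` fixes every such
  `B` exactly** (`c = 1`; "`Ker l(A) = S(A)`").

NOT here: classes of higher degree / on powers (no cycle class map on the carrier; FILE 1's scope note).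

## References

* [Milne1999LefschetzClasses] J. S. Milne, *Lefschetz classes on abelian varieties*, Duke Math. J. 96 (1999) 639–675, §1
  Prop. 1.3 (p. 643), §4 Definition 4.3 and p. 659 L28–L31.
* [Moonen2017FamiliesMotives] B. Moonen, *Families of Motives and the Mumford–Tate Conjecture*, Milan J. Math. 85 (2017), §2.1.
* [DeligneHodgeII1971] P. Deligne, *Théorie de Hodge II*, Publ. Math. IHÉS 40 (1971), 2.1.15.
-/

noncomputable section

open scoped TensorProduct

namespace Literature.AlgebraicGeometry.Motives

namespace HodgeStructure

universe u uK

variable {V : Type u} [AddCommGroup V] [Module ℚ V] [Module.Finite ℚ V] {n : ℤ} {H : HodgeStructure V n}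
  (K : Type uK) [Field K] [Algebra ℚ K] (Q : Polarization H)

omit [Module.Finite ℚ V] in
/-- `B = Q(β ·, ·)` after extension of scalars: `B_K(x, y) = Q_K(β_K x, y)`. Private plumbing. [folklore] -/
private theorem Polarization.baseChange_form_eq_of_form_eq_points {B : LinearMap.BilinForm ℚ V} {β : Module.End ℚ V}
    (hβ : ∀ v w, B v w = Q.form (β v) w) (x y : K ⊗[ℚ] V) :
    B.baseChange K x y = Q.form.baseChange K (β.baseChange K x) y := by
  induction x using TensorProduct.induction_on with
  | zero => simp only [map_zero, LinearMap.zero_apply]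
  | tmul c v =>
    induction y using TensorProduct.induction_on with
    | zero => simp only [map_zero]
    | tmul c' w => simp only [LinearMap.baseChange_tmul, LinearMap.BilinForm.baseChange_tmul, hβ]
    | add y y' hy hy' => simp only [map_add, hy, hy']
  | add x x' hx hx' => simp only [map_add, LinearMap.add_apply, hx, hx']

variable [HodgeTensorFacts.{u, u}]

variable {K} in
/-- **Definition 4.3 through Milne's Prop. 1.3**: `(γ, c) ∈ L(H)(K)` iff `(γ, c)` fixes every bilinear form `B` on `V` that is
`†`-EQUIVARIANT UNDER THE CENTRALISER `C(H)` — "the `k`-linear combinations of forms `e_D`" — in the sense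
`B_K(γ x, γ y) = c · B_K(x, y)`. (Such `B` are exactly the twists `Q(β ·, ·)`, `β ∈ E_φ`, the seat's g18-#2
`Polarization.forall_centralizer_form_apply_adjoint_iff_exists_mem_endAlg`.) [cite: Milne1999LefschetzClasses, §1 Prop. 1.3 (p. 643) and §4 Definition 4.3 (p. 659)] -/
theorem Polarization.mem_extendedLefschetzGroupBaseChange_iff_forall_adjoint (p : ((K ⊗[ℚ] V) ≃ₗ[K] (K ⊗[ℚ] V)) × Kˣ) :
    p ∈ Q.extendedLefschetzGroupBaseChange K ↔
      ∀ B : LinearMap.BilinForm ℚ V,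
        (∀ c ∈ Subalgebra.centralizer ℚ (H.endAlg : Set (Module.End ℚ V)), ∀ v w, B (c v) w = B v (Q.adjoint c w)) →
          ∀ x y, B.baseChange K (p.1 x) (p.1 y) = (p.2 : K) * B.baseChange K x y := by
  constructor
  · intro hp B hB x y
    obtain ⟨β, hβE, hβ⟩ := (Q.forall_centralizer_form_apply_adjoint_iff_exists_mem_endAlg B).1 hB
    rw [Q.baseChange_form_eq_of_form_eq_points K hβ, Q.baseChange_form_eq_of_form_eq_points K hβ]
    exact hp ⟨β, hβE⟩ x y
  · intro h a x y
    have hB := h (Q.form ∘ₗ (a : Module.End ℚ V))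
      ((Q.forall_centralizer_form_apply_adjoint_iff_exists_mem_endAlg _).2 ⟨a, a.2, fun v w ↦ rfl⟩) x y
    rwa [Q.baseChange_form_eq_of_form_eq_points K (B := Q.form ∘ₗ (a : Module.End ℚ V)) (β := (a : Module.End ℚ V))
      (fun v w ↦ rfl), Q.baseChange_form_eq_of_form_eq_points K (B := Q.form ∘ₗ (a : Module.End ℚ V))
      (β := (a : Module.End ℚ V)) (fun v w ↦ rfl)] at hB

variable {K} in
/-- **Definition 4.3 through Hodge classes: `(γ, c) ∈ L(H)(K)` iff `(γ, c)` fixes — `B_K(γ x, γ y) = c · B_K(x, y)` — EVERY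
bilinear form `B` on `V` underlying a morphism of Hodge structures `H ⊗ H → ℚ(-n)`** ("the elements of `D^1_hom`", the image of
the cycle class map: on this carrier the Hodge classes among the `2`-forms, which by the seat's g18-#2
`Polarization.forall_centralizer_form_apply_adjoint_iff_exists_hom` are exactly Milne's `†`-equivariant forms / the twists
`Q(β ·, ·)`, `β ∈ E_φ`; for `H¹(A)`: the `H¹ ⊗ H¹`-components of the divisor classes of `A × A`).
[cite: Milne1999LefschetzClasses, §4 Definition 4.3 (p. 659)] [cite: Moonen2017FamiliesMotives, §2.1] [cite: DeligneHodgeII1971, 2.1.15] -/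
theorem Polarization.mem_extendedLefschetzGroupBaseChange_iff_forall_hom (p : ((K ⊗[ℚ] V) ≃ₗ[K] (K ⊗[ℚ] V)) × Kˣ) :
    p ∈ Q.extendedLefschetzGroupBaseChange K ↔
      ∀ B : LinearMap.BilinForm ℚ V,
        (∃ f : Hom (H.tensor H) ((HodgeStructure.tate (-n)).cast (tate_neg_weight n)), f.toLinearMap = TensorProduct.lift B) →
          ∀ x y, B.baseChange K (p.1 x) (p.1 y) = (p.2 : K) * B.baseChange K x y := by
  rw [Q.mem_extendedLefschetzGroupBaseChange_iff_forall_adjoint]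
  refine forall_congr' fun B ↦ ?_
  rw [Q.forall_centralizer_form_apply_adjoint_iff_exists_hom B]

variable {K} in
/-- **"the kernel of `l(A)` […] equals `S(A)`", through Hodge classes: `γ ∈ S(H)(K)` iff `γ` fixes EXACTLY every bilinear form on `V`
underlying a morphism `H ⊗ H → ℚ(-n)`** (`B_K(γ x, γ y) = B_K(x, y)`). [cite: Milne1999LefschetzClasses, §4 p. 659 L28–L31 and Definition 4.3] -/
theorem Polarization.mem_lefschetzGroupBaseChange_iff_forall_hom (γ : (K ⊗[ℚ] V) ≃ₗ[K] (K ⊗[ℚ] V)) :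
    γ ∈ Q.lefschetzGroupBaseChange K ↔
      ∀ B : LinearMap.BilinForm ℚ V,
        (∃ f : Hom (H.tensor H) ((HodgeStructure.tate (-n)).cast (tate_neg_weight n)), f.toLinearMap = TensorProduct.lift B) →
          ∀ x y, B.baseChange K (γ x) (γ y) = B.baseChange K x y := by
  rw [← Q.mk_one_mem_extendedLefschetzGroupBaseChange_iff γ, Q.mem_extendedLefschetzGroupBaseChange_iff_forall_hom]
  simp only [Units.val_one, one_mul]

variable {K} in
/-- `γ ∈ S(H)(K)` iff `γ` fixes exactly every `†`-equivariant form (Milne's Prop. 1.3 description of the divisor-type classes).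
[cite: Milne1999LefschetzClasses, §1 Prop. 1.3 (p. 643) and §4 p. 659 L28–L31] -/
theorem Polarization.mem_lefschetzGroupBaseChange_iff_forall_adjoint (γ : (K ⊗[ℚ] V) ≃ₗ[K] (K ⊗[ℚ] V)) :
    γ ∈ Q.lefschetzGroupBaseChange K ↔
      ∀ B : LinearMap.BilinForm ℚ V,
        (∀ c ∈ Subalgebra.centralizer ℚ (H.endAlg : Set (Module.End ℚ V)), ∀ v w, B (c v) w = B v (Q.adjoint c w)) →
          ∀ x y, B.baseChange K (γ x) (γ y) = B.baseChange K x y := by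
  rw [← Q.mk_one_mem_extendedLefschetzGroupBaseChange_iff γ, Q.mem_extendedLefschetzGroupBaseChange_iff_forall_adjoint]
  simp only [Units.val_one, one_mul]

end HodgeStructure

end Literature.AlgebraicGeometry.Motives

end
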